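import Summits.PneNP.PneNP.Theorems.Nc03AvoidResidualCoreCandFewHeadsRungFPDecode
import Summits.PneNP.PneNP.Theorems.LtfLocalAvoidCore

/-!
# F-N2a FP wrapper, part 1/2: decoding the code of an all-`MAJ_k` instance by run-length tokens (general `k`)

Cell pnp-ideate, ROUND-17 rung F-N2a (`--supports stmt-PneNP-19007`).  `LtfLocalAvoidCore` proved the
combinatorial half of "pure-`MAJ_k` range avoidance at linear stretch": for a pure `MAJ_k` instance `I`
(`k` odd) with `m > k²·n` outputs the ONE-PASS GREEDY bit-string `greedyBits I` lies outside `Range(I)`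
(`greedyBits_not_mem_range`).  The machine half (this part and `MajLocalAvoidFP`) puts it in the literal
shape of `Literature.Computability.Complexity.LocalAvoidLinearFP k (IsPure (majPred k))`.

This part: the DECODER, for general `k ≥ 1`.  The run-length tokens (`runs` of
`Nc03AvoidResidualCoreCandFewHeadsRungFPDecode`: lengths of the maximal `1`-runs closed by a `0`) of the
code `LocalMap.encode I = 1ⁿ0 · 1ᵐ0 · ∏ⱼ (T · ∏_{i<k} 1^{v_{j,i}}0)` of an instance all of whose tables are
`MAJ_k` are `n, m, (table tokens ++ positions)_{j<m}` (`runs_encode`): the table block `T = tabBits k` is a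
CONSTANT string, so it contributes a constant token list `(tabSt k).1`, and its trailing `1`-run (of
length `tabTail k`; for `MAJ_k` the last rows of the table are `1`s) merges with the unary code of the
FIRST position of the output — `varTok` undoes the shift.  `rowsTok_toks`: the rows read off the tokens
at the fixed offsets are the rows `(v_{j,0}, …, v_{j,k-1})_{j<m}` of the instance.

Restricted-model algorithmic rung of the range-avoidance ladder; no bearing on `P` versus `NP`.
-/

set_option linter.dupNamespace false -- `Summit.PneNP.PneNP.…`: summit = sub-problem name (D-0017 single-conjunct layout)

namespace Summit.PneNP.PneNP.Theorems.MajLocalAvoidFP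

open Literature.Computability.Complexity
open Summit.PneNP.PneNP.Theorems.Nc03AvoidResidualCoreCandFewHeadsRungFP
open Summit.PneNP.PneNP.Theorems.LtfLocalAvoidCore

variable {k n m : ℕ}


/-! ## Tokenizer lemmas (open runs) -/

/-- The list of closed runs only grows: a prefix `d` of closed runs is carried through unchanged. -/
theorem runState_prefix (w : List Bool) : ∀ (d d' : List ℕ) (c : ℕ),
    runState w (d ++ d', c) = (d ++ (runState w (d', c)).1, (runState w (d', c)).2) := by
  induction w with
  | nil => intro d d' c; rfl
  | cons b w ih =>
    intro d d' c
    cases b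
    · rw [runState_cons, runState_cons, runStep_false, runStep_false]
      show runState w ((d ++ d') ++ [c], 0) = (d ++ (runState w (d' ++ [c], 0)).1, (runState w (d' ++ [c], 0)).2)
      rw [List.append_assoc, ih]
    · rw [runState_cons, runState_cons, runStep_true, runStep_true]
      exact ih d d' (c + 1)

/-- Reading a unary code `1ᵃ0` on an open run of length `c` closes ONE run, of length `c + a`. -/
theorem runState_unaryCode_open (a : ℕ) (d : List ℕ) (c : ℕ) (w : List Bool) :
    runState (LocalMap.unaryCode a ++ w) (d, c) = runState w (d ++ [c + a], 0) := by
  rw [LocalMap.unaryCode, List.append_assoc, runState_append, runState_replicate_true,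
    List.singleton_append, runState_cons, runStep_false]

/-- Reading the unary codes of a list of numbers from a fresh run appends the numbers as tokens. -/
theorem runState_unaryCodes (L : List ℕ) : ∀ (d : List ℕ) (w : List Bool),
    runState ((L.map LocalMap.unaryCode).flatten ++ w) (d, 0) = runState w (d ++ L, 0) := by
  induction L with
  | nil => intro d w; simp
  | cons a L ih =>
    intro d w
    rw [List.map_cons, List.flatten_cons, List.append_assoc, runState_unaryCode_open, Nat.zero_add, ih,
      List.append_assoc, List.singleton_append]

/-- Adding `c` to the head of a list of numbers (no-op on `[]`). -/
def bump (c : ℕ) : List ℕ → List ℕ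
  | [] => []
  | v :: rest => (c + v) :: rest

/-- `bump` keeps the length. -/
@[simp] theorem length_bump (c : ℕ) : ∀ L : List ℕ, (bump c L).length = L.length
  | [] => rfl
  | _ :: _ => rfl

/-- Entries of `bump c L`: the head is shifted by `c`, the others are unchanged. -/
theorem getD_bump (c : ℕ) : ∀ (L : List ℕ) (i : ℕ), i < L.length →
    (bump c L).getD i 0 = (if i = 0 then c else 0) + L.getD i 0
  | [], i, h => by simp at h
  | v :: rest, 0, _ => by simp [bump]
  | v :: rest, i + 1, _ => by simp [bump]

/-- Reading the unary codes of a NONEMPTY list of numbers on an open run of length `c`: the first token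
absorbs the open run. -/
theorem runState_unaryCodes_open (v : ℕ) (L : List ℕ) (d : List ℕ) (c : ℕ) (w : List Bool) :
    runState (((v :: L).map LocalMap.unaryCode).flatten ++ w) (d, c) = runState w (d ++ bump c (v :: L), 0) := by
  rw [List.map_cons, List.flatten_cons, List.append_assoc, runState_unaryCode_open, runState_unaryCodes,
    List.append_assoc, List.singleton_append, bump]

/-! ## The code of an all-`MAJ_k` instance and its tokens -/

/-- The table bits of a `MAJ_k` output (rows `p < 2ᵏ` ↦ `MAJ_k(bit₀ p, …, bit_{k-1} p)`): a constant block. -/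
def tabBits (k : ℕ) : List Bool :=
  List.ofFn fun p : Fin (2 ^ k) => majPred k fun i : Fin k => p.val.testBit i.val

/-- The tokenizer state after the table block, read from a fresh run: (closed runs, open run). -/
def tabSt (k : ℕ) : List ℕ × ℕ := runState (tabBits k) ([], 0)

/-- Number of tokens contributed by the table block. -/
def tabLen (k : ℕ) : ℕ := (tabSt k).1.length

/-- Length of the trailing `1`-run of the table block (it merges with the first position code). -/
def tabTail (k : ℕ) : ℕ := (tabSt k).2

/-- Reading the table block appends its tokens and leaves its trailing run open. -/
theorem runState_tabBits (k : ℕ) (d : List ℕ) (w : List Bool) :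
    runState (tabBits k ++ w) (d, 0) = runState w (d ++ (tabSt k).1, tabTail k) := by
  rw [runState_append, show ((d, 0) : List ℕ × ℕ) = (d ++ [], 0) by rw [List.append_nil], runState_prefix]
  rfl

/-- The code block of output `j` inside `LocalMap.encode`. -/
def block (I : LocalMap k n m) (j : Fin m) : List Bool :=
  (List.ofFn fun p : Fin (2 ^ k) => I.table j fun i : Fin k => p.val.testBit i.val) ++
    (List.ofFn fun i : Fin k => LocalMap.unaryCode (I.vars j i).val).flatten

/-- `LocalMap.encode` = the two header codes followed by the per-output blocks. -/
theorem encode_eq (I : LocalMap k n m) :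
    I.encode = LocalMap.unaryCode n ++ LocalMap.unaryCode m ++ ((List.finRange m).map (block I)).flatten := by
  rw [LocalMap.encode, ← List.ofFn_eq_map]
  rfl

/-- The positions of output `j`, as a list of numbers. -/
def rowOf (I : LocalMap k n m) (j : Fin m) : List ℕ := List.ofFn fun i : Fin k => (I.vars j i).val

/-- A row has `k` entries. -/
@[simp] theorem length_rowOf (I : LocalMap k n m) (j : Fin m) : (rowOf I j).length = k := by
  simp [rowOf]

/-- Entry `i` of a row. -/
theorem getD_rowOf (I : LocalMap k n m) (j : Fin m) (i : Fin k) : (rowOf I j).getD i.val 0 = (I.vars j i).val := by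
  rw [rowOf, List.getD_eq_getElem?_getD, List.getElem?_ofFn]
  simp [i.isLt]

/-- The tokens contributed by output `j`: the table tokens, then the positions (the first one shifted by
the table's trailing run). -/
def blockToks (I : LocalMap k n m) (j : Fin m) : List ℕ := (tabSt k).1 ++ bump (tabTail k) (rowOf I j)

/-- Each output contributes `tabLen k + k` tokens. -/
theorem length_blockToks (I : LocalMap k n m) (j : Fin m) : (blockToks I j).length = tabLen k + k := by
  rw [blockToks, List.length_append, length_bump, length_rowOf, tabLen]

/-- Reading the block of a `MAJ_k` output (`k ≥ 1`) appends its tokens. -/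
theorem runState_block {I : LocalMap k n m} (hI : ∀ j, I.table j = majPred k) (hk : 0 < k) (j : Fin m)
    (d : List ℕ) (w : List Bool) : runState (block I j ++ w) (d, 0) = runState w (d ++ blockToks I j, 0) := by
  have htab : (List.ofFn fun p : Fin (2 ^ k) => I.table j fun i : Fin k => p.val.testBit i.val) = tabBits k := by
    rw [hI j]; rfl
  have hpos : (List.ofFn fun i : Fin k => LocalMap.unaryCode (I.vars j i).val) =
      (rowOf I j).map LocalMap.unaryCode := by
    rw [rowOf, List.map_ofFn]; rfl
  have hne : rowOf I j ≠ [] := by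
    rw [← List.length_pos_iff_ne_nil, length_rowOf]; exact hk
  obtain ⟨v, L, hvL⟩ := List.exists_cons_of_ne_nil hne
  rw [block, htab, hpos, List.append_assoc, runState_tabBits, hvL, runState_unaryCodes_open, blockToks, hvL,
    List.append_assoc]

/-- Reading the blocks of a list of outputs appends their tokens in order. -/
theorem runState_blocks {I : LocalMap k n m} (hI : ∀ j, I.table j = majPred k) (hk : 0 < k)
    (Ljs : List (Fin m)) (d : List ℕ) (w : List Bool) :
    runState ((Ljs.map (block I)).flatten ++ w) (d, 0) =
      runState w (d ++ (Ljs.map (blockToks I)).flatten, 0) := by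
  induction Ljs generalizing d with
  | nil => simp
  | cons j Ljs ih =>
    rw [List.map_cons, List.flatten_cons, List.append_assoc, runState_block hI hk, ih, List.map_cons,
      List.flatten_cons, List.append_assoc]

/-- The token list of an all-`MAJ_k` instance. -/
def toks (I : LocalMap k n m) : List ℕ := n :: m :: ((List.finRange m).map (blockToks I)).flatten

/-- **Tokens of the code of an all-`MAJ_k` instance (`k ≥ 1`).** -/
theorem runs_encode {I : LocalMap k n m} (hI : ∀ j, I.table j = majPred k) (hk : 0 < k) :
    runs I.encode = toks I := by
  have h : I.encode = LocalMap.unaryCode n ++ (LocalMap.unaryCode m ++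
      (((List.finRange m).map (block I)).flatten ++ [])) := by
    rw [encode_eq, List.append_nil, List.append_assoc]
  rw [runs, h, runState_unaryCode, runState_unaryCode, runState_blocks hI hk]
  simp [runState, toks]

/-! ## Reading the rows off the tokens -/

/-- Token `t` of block `j` sits at position `(tabLen k + k)·j + t` of the flattened block tokens. -/
theorem getD_flatten_blocks (I : LocalMap k n m) (d : ℕ) {t : ℕ} (ht : t < tabLen k + k) :
    ∀ (Ljs : List (Fin m)) (j : ℕ) (hj : j < Ljs.length),
      ((Ljs.map (blockToks I)).flatten).getD ((tabLen k + k) * j + t) d = (blockToks I (Ljs[j])).getD t d := by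
  intro Ljs
  induction Ljs with
  | nil => intro j hj; simp at hj
  | cons x Ljs ih =>
    intro j hj
    rw [List.map_cons, List.flatten_cons]
    cases j with
    | zero =>
      rw [Nat.mul_zero, Nat.zero_add, List.getD_append _ _ _ _ (by rw [length_blockToks]; exact ht)]
      rfl
    | succ j =>
      rw [List.getD_append_right _ _ _ _ (by rw [length_blockToks]; nlinarith), length_blockToks,
        show (tabLen k + k) * (j + 1) + t - (tabLen k + k) = (tabLen k + k) * j + t by
          rw [Nat.mul_succ]; omega,
        ih j (by simpa using hj)]
      rfl

/-- Token `1` is the number of outputs `m`. -/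
theorem toks_getD_one (I : LocalMap k n m) : (toks I).getD 1 0 = m := rfl

/-- Token `(tabLen k + k)·j + 2 + t` is token `t` of the block of output `j`. -/
theorem toks_getD_field (I : LocalMap k n m) (j : Fin m) {t : ℕ} (ht : t < tabLen k + k) :
    (toks I).getD ((tabLen k + k) * j.val + 2 + t) 0 = (blockToks I j).getD t 0 := by
  rw [toks, show (tabLen k + k) * j.val + 2 + t = ((tabLen k + k) * j.val + t) + 1 + 1 by omega,
    List.getD_cons_succ, List.getD_cons_succ,
    getD_flatten_blocks I 0 ht _ _ (by rw [List.length_finRange]; exact j.isLt), List.getElem_finRange]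
  rfl

/-- Position `i` of output `j`, read off the tokens (the first position un-shifted by the table's trailing run). -/
def varTok (k : ℕ) (ts : List ℕ) (j i : ℕ) : ℕ :=
  ts.getD ((tabLen k + k) * j + 2 + (tabLen k + i)) 0 - if i = 0 then tabTail k else 0

/-- **Decoding one position.** -/
theorem varTok_toks (I : LocalMap k n m) (j : Fin m) (i : Fin k) : varTok k (toks I) j.val i.val = (I.vars j i).val := by
  rw [varTok, toks_getD_field I j (by omega), blockToks,
    List.getD_append_right _ _ _ _ (by rw [tabLen]; omega), tabLen, Nat.add_sub_cancel_left,
    getD_bump _ _ _ (by rw [length_rowOf]; exact i.isLt), getD_rowOf, Nat.add_sub_cancel_left]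

/-- Row `j`, read off the tokens. -/
def rowTok (k : ℕ) (ts : List ℕ) (j : ℕ) : List ℕ := (List.range k).map (varTok k ts j)

/-- **Decoding one row.** -/
theorem rowTok_toks (I : LocalMap k n m) (j : Fin m) : rowTok k (toks I) j.val = rowOf I j := by
  apply List.ext_getElem
  · simp [rowTok]
  · intro i h₁ h₂
    rw [length_rowOf] at h₂
    simp only [rowTok, List.getElem_map, List.getElem_range, rowOf, List.getElem_ofFn]
    exact varTok_toks I j ⟨i, h₂⟩

/-- All rows, read off the tokens (`m` = token `1`). -/
def rowsTok (k : ℕ) (ts : List ℕ) : List (List ℕ) := (List.range (ts.getD 1 0)).map (rowTok k ts)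

/-- The rows of the instance. -/
def rows (I : LocalMap k n m) : List (List ℕ) := (List.finRange m).map (rowOf I)

/-- **Decoding**: the rows read off the tokens of the code are the rows of the instance. -/
theorem rowsTok_toks (I : LocalMap k n m) : rowsTok k (toks I) = rows I := by
  rw [rowsTok, toks_getD_one, ← List.map_coe_finRange_eq_range, List.map_map, rows]
  exact List.map_congr_left fun j _ => rowTok_toks I j

end Summit.PneNP.PneNP.Theorems.MajLocalAvoidFP
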